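import Summits.BirchSwinnertonDyer.BirchSwinnertonDyer.Theorems.BiquadraticEisensteinDescentManinDatumSupercuspidalCMInertTorsionCoordinatesJZero
import Mathlib.NumberTheory.Padics.PadicVal.Basic
import HarnessLib

set_option linter.dupNamespace false -- `Summit.BirchSwinnertonDyer.BirchSwinnertonDyer.Theorems.…` (summit = sub, D-0017)
set_option autoImplicit false

/-!
# Crux `ManinDatumSupercuspidalCMInert` (stmt-BirchSwinnertonDyer-20111, BED r605): the POWER-BASIS READOUT — valuations of
# `Σ_j q_j ρ^j` (`q_j ∈ ℚ`, `v(ρ)^e = v(p)`) at a valuation above `p`, prime-generic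
# (width seat `bsd-wall-cm-bed-w2` g10; theorems only; route-independent imports; `--supports 20111`, helper)

Route `BiquadraticEisensteinDescent` (cell `pub/bsd-wall`). The last generic step of bed-w3 g10's Galois-free certificate for RES₇fin
(`…ResolventBoundReduction`, p641835): once a resolvent is written in a power basis, `R = Σ_{j<N} q_j ρ^j` with RATIONAL `q_j` and `v(ρ)^e = v(p)`
(`ρ = π₁²`, `e = 12`, `p = 7`: `v(π₁)²⁴ = v 7` by bed-w4 g10's `val_weierstrassP_seven_div`), its valuation bound is read off coefficientwise. For an
arbitrary field `F`, a valuation `v` on `F` with `v p < 1` (`p` prime):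

* (`v ℓ = 1` for `ℓ` prime to `p`: bed-w1 g8's `…TorsionCoordinatesJZero.val_natCast_eq_one_of_coprime`, reused) `val_natCast_eq_pow_padicValNat`, `val_intCast_eq_pow_padicValInt`,
  ★ `val_ratCast_eq_zpow` — **`v(q) = v(p)^{ord_p q}`** for `q ∈ ℚˣ`;
* `zpow_readout_aux` — exponent bookkeeping; ★ `val_sum_pow_le_of_readout` — if `v(ρ)^e = v(p)` (`0 < e`), `d ≠ 0`, and for every `j < N` either
  `q_j = 0` or `e(d − k) ≤ e·d·ord_p(q_j) + d·j`, then **`v(Σ_{j<N} q_j ρ^j)^d ≤ v(p)^{d−k}`** (ultrametric inequality termwise; no linear independence /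
  distinct-valuation argument is needed for the UPPER bound);
* `val_pow_mul_intCast_div_natCast_le`, ★ `val_sum_pow_le_of_coeff_bound` — the same readout from per-coefficient WITNESSES `v(c_j) ≤ v(p)^{w_j}`
  and `c_j = 0 ∨ e(d − k) ≤ e·d·w_j + d·j` (all in `ℕ`, `norm_num`/`omega`-checkable; bed-w3 g10's request 14:51:40Z), with the S7 forms
  `val_sum_pow_four_le_seven_of_coeff_bound` (`3(4 − k) ≤ 12 w_j + j`) and `val_seven_pow_mul_intCast_div_two_pow_le` (`v(7^e N/2^d) ≤ v 7^e`);
* `val_sq_pow_twelve_of_pow_twentyfour`, ★ `val_sum_pow_four_le_seven_of_readout` — the S7 instance `(p, e, d) = (7, 12, 4)`: `v(π)²⁴ = v 7`, `ρ = π²`,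
  `k ≤ 4`, and `q_j = 0 ∨ 12 − 3k ≤ 12·ord₇(q_j) + j` for `j < N` ⇒ `v(Σ_{j<N} q_j ρ^j)⁴ ≤ v(7)^{4−k}` — one pair `(k, n)` of RES₇fin as soon as the
  identity `R_n^{(k)} = Σ_j q_j ρ₁^j` is supplied.

HONEST FRAMING: no resolvent identity is proved here; nothing in this file proves RES₇fin, the stub, the crux, Manin's conjecture or BSD. No definition,
no named fact, no `sorry`; axioms standard.
-/

noncomputable section

open scoped Classical

namespace Summit.BirchSwinnertonDyer.BirchSwinnertonDyer.Theorems.BiquadraticEisensteinDescentManinDatumSupercuspidalCMInertPowerBasisReadout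

open Summit.BirchSwinnertonDyer.BirchSwinnertonDyer.Theorems.BiquadraticEisensteinDescentManinDatumSupercuspidalCMInertSevenDivisionEisenstein
  (val_intCast_le_one)
open Summit.BirchSwinnertonDyer.BirchSwinnertonDyer.Theorems.BiquadraticEisensteinDescentManinDatumSupercuspidalCMInertTorsionCoordinatesJZero
  (val_natCast_eq_one_of_coprime)

section Valued

variable {F Γ₀ : Type*} [Field F] [LinearOrderedCommGroupWithZero Γ₀] (v : Valuation F Γ₀)

/-! ## §1 Rational numbers at a valuation above `p` -/

/-- **`v n = v(p)^{ord_p n}`** for a natural number `n ≠ 0` (`n = p^{ord_p n}·m`, `p ∤ m`). [folklore] -/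
theorem val_natCast_eq_pow_padicValNat {p : ℕ} (hp : p.Prime) (hv : v (p : F) < 1) {n : ℕ} (hn : n ≠ 0) :
    v (n : F) = v (p : F) ^ padicValNat p n := by
  haveI : Fact p.Prime := ⟨hp⟩
  obtain ⟨m, hm⟩ := pow_padicValNat_dvd (p := p) (n := n)
  have hpm : ¬ p ∣ m := by
    intro hd
    have h : p ^ (padicValNat p n + 1) ∣ n := by
      rw [pow_succ]
      calc p ^ padicValNat p n * p ∣ p ^ padicValNat p n * m := mul_dvd_mul_left _ hd
        _ = n := hm.symm
    exact pow_succ_padicValNat_not_dvd hn h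
  have hcop : Nat.Coprime m p := (hp.coprime_iff_not_dvd.mpr hpm).symm
  have hcast : (n : F) = (p : F) ^ padicValNat p n * m := by
    rw [congrArg (Nat.cast : ℕ → F) hm, Nat.cast_mul, Nat.cast_pow]
  rw [hcast, Valuation.map_mul, Valuation.map_pow, val_natCast_eq_one_of_coprime v hv hcop, mul_one]

/-- **`v m = v(p)^{ord_p m}`** for an integer `m ≠ 0`. [folklore] -/
theorem val_intCast_eq_pow_padicValInt {p : ℕ} (hp : p.Prime) (hv : v (p : F) < 1) {m : ℤ} (hm : m ≠ 0) :
    v (m : F) = v (p : F) ^ padicValInt p m := by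
  have hn : m.natAbs ≠ 0 := Int.natAbs_ne_zero.mpr hm
  have key : v (m : F) = v ((m.natAbs : ℕ) : F) := by
    rcases Int.natAbs_eq m with h | h
    · conv_lhs => rw [h]
      rw [Int.cast_natCast]
    · conv_lhs => rw [h]
      rw [Int.cast_neg, Int.cast_natCast, Valuation.map_neg]
  rw [key, val_natCast_eq_pow_padicValNat v hp hv hn, padicValInt]

/-- ★ **`v q = v(p)^{ord_p q}`** (an integer power in the value group) for a rational `q ≠ 0`, at any valuation of a field of characteristic
`0` with `v p < 1`. [folklore] -/
theorem val_ratCast_eq_zpow [CharZero F] {p : ℕ} (hp : p.Prime) (hv : v (p : F) < 1) {q : ℚ} (hq : q ≠ 0) :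
    v (q : F) = v (p : F) ^ padicValRat p q := by
  have hp0 : v (p : F) ≠ 0 := (Valuation.ne_zero_iff v).mpr (Nat.cast_ne_zero.mpr hp.ne_zero)
  rw [Rat.cast_def, map_div₀, val_intCast_eq_pow_padicValInt v hp hv (Rat.num_ne_zero.mpr hq),
    val_natCast_eq_pow_padicValNat v hp hv q.den_pos.ne', padicValRat, zpow_sub₀ hp0, zpow_natCast, zpow_natCast]

/-! ## §2 The readout -/

/-- Exponent bookkeeping in the value group: `((t^e)^a · t^j)^d = t^{e·d·a + d·j}` (`t ≠ 0`, `a ∈ ℤ`). [folklore] -/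
theorem zpow_readout_aux {t : Γ₀} (ht : t ≠ 0) (e j d : ℕ) (a : ℤ) :
    ((t ^ e) ^ a * t ^ j) ^ d = t ^ ((e : ℤ) * d * a + d * j) := by
  rw [show ((e : ℤ) * d * a + d * j) = ((e : ℤ) * a + j) * d by ring, zpow_mul, zpow_natCast]
  congr 1
  rw [zpow_add₀ ht, zpow_mul, zpow_natCast, zpow_natCast]

/-- ★ **The power-basis readout.** Let `v` be a valuation of a field `F` of characteristic `0` with `v p < 1` (`p` prime), `ρ ∈ F` with
`v(ρ)^e = v(p)` (`0 < e`), `d ≠ 0`, and `q : ℕ → ℚ`. If for every `j < N` either `q_j = 0` or `e·(d − k) ≤ e·d·ord_p(q_j) + d·j` (in `ℤ`; natural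
subtraction `d − k`), then `v(Σ_{j<N} q_j ρ^j)^d ≤ v(p)^{d−k}`: each term has `v(q_j ρ^j)^d = v(ρ)^{e·d·ord_p(q_j) + d·j} ≤ v(ρ)^{e(d−k)} = v(p)^{d−k}`
(`v ρ < 1`), and `v` of a sum is at most the maximum over the summands. [folklore] [cite: Serre1979, Ch. I §6] -/
theorem val_sum_pow_le_of_readout [CharZero F] {p : ℕ} (hp : p.Prime) (hv : v (p : F) < 1) {e d k : ℕ} (he : 0 < e) (hd : d ≠ 0)
    {ρ : F} (hρ : v ρ ^ e = v (p : F)) (N : ℕ) (q : ℕ → ℚ)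
    (hq : ∀ j < N, q j = 0 ∨ ((e * (d - k) : ℕ) : ℤ) ≤ (e : ℤ) * d * padicValRat p (q j) + d * j) :
    v (∑ j ∈ Finset.range N, (q j : F) * ρ ^ j) ^ d ≤ v (p : F) ^ (d - k) := by
  have hp0 : v (p : F) ≠ 0 := (Valuation.ne_zero_iff v).mpr (Nat.cast_ne_zero.mpr hp.ne_zero)
  have hρ0 : v ρ ≠ 0 := fun h ↦ by
    rw [h, zero_pow he.ne'] at hρ
    exact hp0 hρ.symm
  have ht0 : 0 < v ρ := lt_of_le_of_ne zero_le (Ne.symm hρ0)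
  have ht1 : v ρ < 1 := by
    by_contra h
    push Not at h
    have h1 : 1 ≤ v ρ ^ e := one_le_pow_of_one_le' h e
    rw [hρ] at h1
    exact absurd hv (not_lt.mpr h1)
  -- a sum is bounded by its largest term
  have hsum : v (∑ j ∈ Finset.range N, (q j : F) * ρ ^ j) ^ d ≤ v ρ ^ (e * (d - k)) := by
    rcases (Finset.range N).eq_empty_or_nonempty with hs | hs
    · rw [hs, Finset.sum_empty, Valuation.map_zero, zero_pow hd]; exact zero_le
    · obtain ⟨i, hi, hmax⟩ := Finset.exists_max_image (Finset.range N) (fun j ↦ v ((q j : F) * ρ ^ j)) hs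
      have hle : v (∑ j ∈ Finset.range N, (q j : F) * ρ ^ j) ≤ v ((q i : F) * ρ ^ i) :=
        Valuation.map_sum_le v fun j hj ↦ hmax j hj
      refine le_trans (pow_le_pow_left₀ zero_le hle d) ?_
      -- the term `i`
      by_cases hqi : q i = 0
      · rw [hqi, Rat.cast_zero, zero_mul, Valuation.map_zero, zero_pow hd]; exact zero_le
      · have hineq : ((e * (d - k) : ℕ) : ℤ) ≤ (e : ℤ) * d * padicValRat p (q i) + d * i :=
          (hq i (Finset.mem_range.mp hi)).resolve_left hqi
        rw [Valuation.map_mul, Valuation.map_pow, val_ratCast_eq_zpow v hp hv hqi, ← hρ, zpow_readout_aux hρ0,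
          ← zpow_natCast (v ρ) (e * (d - k))]
        exact (zpow_le_zpow_iff_right_of_lt_one₀ ht0 ht1).mpr hineq
  calc v (∑ j ∈ Finset.range N, (q j : F) * ρ ^ j) ^ d ≤ v ρ ^ (e * (d - k)) := hsum
    _ = v (p : F) ^ (d - k) := by rw [pow_mul, hρ]

/-! ## §2b The readout from FACTORISATION WITNESSES (no `padicValRat`: everything `norm_num`/`decide`-checkable) -/

/-- **Coefficient bound from a witness.** `v(p^e · N / D) ≤ v(p)^e` for an integer `N` and a natural `D` prime to `p` (`v N ≤ 1`, `v D = 1`).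
[folklore] -/
theorem val_pow_mul_intCast_div_natCast_le {p : ℕ} (hp : p.Prime) (hv : v (p : F) < 1) (e : ℕ) (N : ℤ) {D : ℕ} (hD : ¬ p ∣ D) :
    v ((p : F) ^ e * N / D) ≤ v (p : F) ^ e := by
  have hD1 : v (D : F) = 1 := val_natCast_eq_one_of_coprime v hv (hp.coprime_iff_not_dvd.mpr hD).symm
  rw [map_div₀, hD1, div_one, Valuation.map_mul, Valuation.map_pow]
  calc v (p : F) ^ e * v (N : F) ≤ v (p : F) ^ e * 1 := mul_le_mul' le_rfl (val_intCast_le_one v N)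
    _ = v (p : F) ^ e := mul_one _

/-- ★ **The power-basis readout from coefficient bounds.** Let `v(ρ)^e = v(p)` with `v p < 1`, `d ≠ 0`, coefficients `c : ℕ → F` with
`v(c_j) ≤ v(p)^{w_j}` and, for every `j < N`, `c_j = 0 ∨ e·(d − k) ≤ e·d·w_j + d·j` (natural numbers). Then `v(Σ_{j<N} c_j ρ^j)^d ≤ v(p)^{d−k}`.
(For bed-w3 g10's certificate: `c_j = 7^{e_j}·N_j/2^{d_j}`, `w_j = e_j` by `val_pow_mul_intCast_div_natCast_le`.) [folklore] [cite: Serre1979, Ch. I §6] -/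
theorem val_sum_pow_le_of_coeff_bound {p : ℕ} (hv : v (p : F) < 1) {e d k : ℕ} (hd : d ≠ 0)
    {ρ : F} (hρ : v ρ ^ e = v (p : F)) (N : ℕ) (c : ℕ → F) (w : ℕ → ℕ)
    (hc : ∀ j < N, v (c j) ≤ v (p : F) ^ (w j)) (hw : ∀ j < N, c j = 0 ∨ e * (d - k) ≤ e * d * w j + d * j) :
    v (∑ j ∈ Finset.range N, c j * ρ ^ j) ^ d ≤ v (p : F) ^ (d - k) := by
  have hρ1 : v ρ ≤ 1 := by
    by_contra h
    push Not at h
    have h1 : 1 ≤ v ρ ^ e := one_le_pow_of_one_le' h.le e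
    rw [hρ] at h1
    exact absurd hv (not_lt.mpr h1)
  have hsum : v (∑ j ∈ Finset.range N, c j * ρ ^ j) ^ d ≤ v ρ ^ (e * (d - k)) := by
    rcases (Finset.range N).eq_empty_or_nonempty with hs | hs
    · rw [hs, Finset.sum_empty, Valuation.map_zero, zero_pow hd]; exact zero_le
    · obtain ⟨i, hi, hmax⟩ := Finset.exists_max_image (Finset.range N) (fun j ↦ v (c j * ρ ^ j)) hs
      have hle : v (∑ j ∈ Finset.range N, c j * ρ ^ j) ≤ v (c i * ρ ^ i) := Valuation.map_sum_le v fun j hj ↦ hmax j hj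
      refine le_trans (pow_le_pow_left₀ zero_le hle d) ?_
      have hiN := Finset.mem_range.mp hi
      rcases hw i hiN with h0 | hineq
      · rw [h0, zero_mul, Valuation.map_zero, zero_pow hd]; exact zero_le
      · rw [Valuation.map_mul, Valuation.map_pow, mul_pow, ← pow_mul]
        calc v (c i) ^ d * v ρ ^ (i * d) ≤ (v (p : F) ^ w i) ^ d * v ρ ^ (i * d) :=
              mul_le_mul' (pow_le_pow_left₀ zero_le (hc i hiN) d) le_rfl
          _ = v ρ ^ (e * d * w i + d * i) := by
              rw [← hρ, ← pow_mul, ← pow_mul, ← pow_add]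
              congr 1
              ring
          _ ≤ v ρ ^ (e * (d - k)) := pow_le_pow_right_of_le_one' hρ1 hineq
  calc v (∑ j ∈ Finset.range N, c j * ρ ^ j) ^ d ≤ v ρ ^ (e * (d - k)) := hsum
    _ = v (p : F) ^ (d - k) := by rw [pow_mul, hρ]

/-! ## §3 The S7 instance `(p, e, d) = (7, 12, 4)` -/

/-- `v(π)²⁴ = v 7 ⇒ v(π²)¹² = v 7` (the power basis of the certificate is `ρ₁ = π₁²`). [folklore] -/
theorem val_sq_pow_twelve_of_pow_twentyfour {π : F} (hπ : v π ^ 24 = v (7 : F)) : v (π ^ 2) ^ 12 = v (7 : F) := by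
  rw [Valuation.map_pow, ← pow_mul]
  exact hπ

/-- ★ **S7 readout.** `v 7 < 1`, `v(ρ)¹² = v 7`, `k ≤ 4`, `q : ℕ → ℚ` with `q_j = 0 ∨ 12 − 3k ≤ 12·ord₇(q_j) + j` for all `j < N`
⇒ `v(Σ_{j<N} q_j ρ^j)⁴ ≤ v(7)^{4−k}` — one pair `(k, n)` of RES₇fin (`…ResolventBoundReduction`) once `R_n^{(k)} = Σ_j q_j ρ₁^j` is rewritten in.
[folklore] [cite: Serre1979, Ch. I §6] -/
theorem val_sum_pow_four_le_seven_of_readout [CharZero F] (hv : v (7 : F) < 1) {k : ℕ} (hk : k ≤ 4) {ρ : F}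
    (hρ : v ρ ^ 12 = v (7 : F)) (N : ℕ) (q : ℕ → ℚ)
    (hq : ∀ j < N, q j = 0 ∨ (12 : ℤ) - 3 * k ≤ 12 * padicValRat 7 (q j) + j) :
    v (∑ j ∈ Finset.range N, (q j : F) * ρ ^ j) ^ 4 ≤ v (7 : F) ^ (4 - k) := by
  have h7 : v ((7 : ℕ) : F) < 1 := by exact_mod_cast hv
  have hρ' : v ρ ^ 12 = v ((7 : ℕ) : F) := by exact_mod_cast hρ
  have h := val_sum_pow_le_of_readout v (by norm_num : (7 : ℕ).Prime) h7 (e := 12) (d := 4) (k := k) (by norm_num) (by norm_num)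
    hρ' N q (fun j hj ↦ ?_)
  · exact_mod_cast h
  · rcases hq j hj with h0 | hle
    · exact Or.inl h0
    · right
      omega

/-- ★ **S7 readout from witnesses** (bed-w3 g10's request, 14:51:40Z): `v 7 < 1`, `v(ρ)¹² = v 7`, coefficients `c_j` with
`v(c_j) ≤ v(7)^{w_j}` (e.g. `c_j = 7^{w_j}·N_j/2^{d_j}` by `val_pow_mul_intCast_div_natCast_le`) and `c_j = 0 ∨ 3(4 − k) ≤ 12·w_j + j` for `j < N`
⇒ `v(Σ_{j<N} c_j ρ^j)⁴ ≤ v(7)^{4−k}`. [folklore] [cite: Serre1979, Ch. I §6] -/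
theorem val_sum_pow_four_le_seven_of_coeff_bound (hv : v (7 : F) < 1) {k : ℕ} {ρ : F} (hρ : v ρ ^ 12 = v (7 : F))
    (N : ℕ) (c : ℕ → F) (w : ℕ → ℕ) (hc : ∀ j < N, v (c j) ≤ v (7 : F) ^ (w j))
    (hw : ∀ j < N, c j = 0 ∨ 3 * (4 - k) ≤ 12 * w j + j) :
    v (∑ j ∈ Finset.range N, c j * ρ ^ j) ^ 4 ≤ v (7 : F) ^ (4 - k) := by
  have h7 : v ((7 : ℕ) : F) < 1 := by exact_mod_cast hv
  have hρ' : v ρ ^ 12 = v ((7 : ℕ) : F) := by exact_mod_cast hρ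
  have hc' : ∀ j < N, v (c j) ≤ v ((7 : ℕ) : F) ^ (w j) := fun j hj ↦ by exact_mod_cast hc j hj
  have h := val_sum_pow_le_of_coeff_bound v h7 (e := 12) (d := 4) (k := k) (by norm_num) hρ' N c w hc'
    (fun j hj ↦ ?_)
  · exact_mod_cast h
  · rcases hw j hj with h0 | hle
    · exact Or.inl h0
    · right
      omega

/-- **Witness form of the coefficient bound at `7` with a power-of-two denominator** (the shape of bed-w3 g10's `q_j`):
`v(7^e · N / 2^d) ≤ v(7)^e`. [folklore] -/
theorem val_seven_pow_mul_intCast_div_two_pow_le (hv : v (7 : F) < 1) (e : ℕ) (N : ℤ) (d : ℕ) :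
    v ((7 : F) ^ e * N / (2 : F) ^ d) ≤ v (7 : F) ^ e := by
  have h7 : v ((7 : ℕ) : F) < 1 := by exact_mod_cast hv
  have h2 : ¬ 7 ∣ 2 ^ d := fun h ↦ by
    have := (Nat.Prime.dvd_of_dvd_pow (by norm_num : (7 : ℕ).Prime) h)
    omega
  have h := val_pow_mul_intCast_div_natCast_le v (by norm_num : (7 : ℕ).Prime) h7 e N (D := 2 ^ d) h2
  push_cast at h
  exact h

/-! ## §4 The S5 instance `(p, e, d) = (5, 12, 6)` (bed-w1 g8's `j = 0` certificate, 15:09:15Z) -/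

/-- **Witness form of the coefficient bound at `5` with a power-of-two denominator**: `v(5^e · N / 2^d) ≤ v(5)^e`. [folklore] -/
theorem val_five_pow_mul_intCast_div_two_pow_le (hv : v (5 : F) < 1) (e : ℕ) (N : ℤ) (d : ℕ) :
    v ((5 : F) ^ e * N / (2 : F) ^ d) ≤ v (5 : F) ^ e := by
  have h5 : v ((5 : ℕ) : F) < 1 := by exact_mod_cast hv
  have h2 : ¬ 5 ∣ 2 ^ d := fun h ↦ by
    have := (Nat.Prime.dvd_of_dvd_pow (by norm_num : (5 : ℕ).Prime) h)
    omega
  have h := val_pow_mul_intCast_div_natCast_le v (by norm_num : (5 : ℕ).Prime) h5 e N (D := 2 ^ d) h2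
  push_cast at h
  exact h

/-- ★ **S5 readout from witnesses**: `v 5 < 1`, `v(ρ)¹² = v 5` (e.g. `ρ = π₁` a root of the reversed `ψ₅`-polynomial of bed-w1 g8's
`…FiveDivisionEisensteinJZero`), coefficients `c_j` with `v(c_j) ≤ v(5)^{w_j}` and `c_j = 0 ∨ 2(6 − k) ≤ 12·w_j + j` for `j < N`
⇒ `v(Σ_{j<N} c_j ρ^j)⁶ ≤ v(5)^{6−k}` — one pair `(k, n)` of the `j = 0` resolvent bound RES₅ once `R_n^{(k)} = Σ_j c_j ρ^j` is rewritten in.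
[folklore] [cite: Serre1979, Ch. I §6] -/
theorem val_sum_pow_six_le_five_of_coeff_bound (hv : v (5 : F) < 1) {k : ℕ} {ρ : F} (hρ : v ρ ^ 12 = v (5 : F))
    (N : ℕ) (c : ℕ → F) (w : ℕ → ℕ) (hc : ∀ j < N, v (c j) ≤ v (5 : F) ^ (w j))
    (hw : ∀ j < N, c j = 0 ∨ 2 * (6 - k) ≤ 12 * w j + j) :
    v (∑ j ∈ Finset.range N, c j * ρ ^ j) ^ 6 ≤ v (5 : F) ^ (6 - k) := by
  have h5 : v ((5 : ℕ) : F) < 1 := by exact_mod_cast hv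
  have hρ' : v ρ ^ 12 = v ((5 : ℕ) : F) := by exact_mod_cast hρ
  have hc' : ∀ j < N, v (c j) ≤ v ((5 : ℕ) : F) ^ (w j) := fun j hj ↦ by exact_mod_cast hc j hj
  have h := val_sum_pow_le_of_coeff_bound v h5 (e := 12) (d := 6) (k := k) (by norm_num) hρ' N c w hc'
    (fun j hj ↦ ?_)
  · exact_mod_cast h
  · rcases hw j hj with h0 | hle
    · exact Or.inl h0
    · right
      omega

end Valued

end Summit.BirchSwinnertonDyer.BirchSwinnertonDyer.Theorems.BiquadraticEisensteinDescentManinDatumSupercuspidalCMInertPowerBasisReadout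

end
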